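import Literature.Computability.AlgebraicComplexity.SOSTauTransfer
import Summits.ValiantsHypothesis.ValiantsHypothesis.Theorems.SOSTauOfSOSTau
import Summits.ValiantsHypothesis.ValiantsHypothesis.Theorems.SOSTauHutchinsonMagnification

/-!
# Dutta 2021, Theorem 2 BY NAME: the SoS-τ-conjecture implies `VP ℂ ≠ VNP ℂ` — UNCONDITIONAL

The named fact `Literature.Computability.AlgebraicComplexity.Dutta2021_theorem2`
(`SOSTauTransfer.lean`; P. Dutta, *Real τ-conjecture for sum-of-squares: a unified approach to
lower bound and derandomization*, CSR 2021, Theorem 2; restated in Bürgisser 2024, §4.6 after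
statement 4.2) is a THEOREM of the tree: its antecedent is, symbol for symbol, the body of the
crux `Theses.SOSTau.SOSTau` of route `SOSTau` of `ValiantsHypothesis`, and its conclusion
`VP ℂ ≠ VNP ℂ` is the summit statement `ValiantsHypothesis` unfolded; the two CLOSED items of that
route compose to it —

* `Theorems.SOSTau.ofSOSTau_proof` (`OfSOSTau`, stmt-ValiantsHypothesis-18752): the SoS-τ bound
  gives linear sparse-SOS hardness of the Tavenas–Hutchinson family `V_n` (`2^n - 1` distinct
  real zeros against `c · Σ |supp g_i|`);
* `Theorems.SOSTauHutchinsonMagnification.HutchinsonMagnification_proof`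
  (`HutchinsonMagnification`, stmt-ValiantsHypothesis-18749): that hardness implies
  `ValiantsHypothesis` (Dutta's printed chain: digit lift in `VNP_ℂ = VP_ℂ`, VSBR middle cut into
  a cheap complex weighted sum of squares, Lemma 10 complex-to-real, contradiction).

This file lives Summit-side because the proof of the Literature fact IS the route (a Literature
module cannot import `Summits.*`); precedent: `Summits/ABC/ABC/Theorems/StewartTijdeman1986Holds.lean`.
Honest framing: the SoS-τ-conjecture is an open problem; VP ≠ VNP is NOT proved and nothing here is
progress on it — this discharges the printed IMPLICATION.
-/

noncomputable section

-- the summit and the problem share the name `ValiantsHypothesis` (D-0017 single-conjunct layout)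
set_option linter.dupNamespace false

namespace Summit.ValiantsHypothesis.ValiantsHypothesis.Theorems.SOSTau

open Literature.Computability.AlgebraicComplexity

/-- **Dutta 2021, Theorem 2** (discharge of the named fact `Dutta2021_theorem2`): if an absolute
`c` bounds the number of distinct real zeros of every real weighted sum of squares `Σ a_i g_i²` by
`c · Σ |supp g_i|`, then `VP ℂ ≠ VNP ℂ` — `HutchinsonMagnification_proof ∘ ofSOSTau_proof`.
[cite: Dutta2021, Theorem 2] -/
theorem Dutta2021_theorem2_holds : Dutta2021_theorem2 := fun hSOS =>
  Summit.ValiantsHypothesis.ValiantsHypothesis.Theorems.SOSTauHutchinsonMagnification.HutchinsonMagnification_proof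
    (ofSOSTau_proof hSOS)

end Summit.ValiantsHypothesis.ValiantsHypothesis.Theorems.SOSTau
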